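import Summits.Ventures.PercRepro.ProfileGapMonoThresholdThreeLinesAll

/-!
# PercRepro — CO-RANK 3 AT NULLITY ≤ 2: THE SANDWICH AROUND THE OPEN CORE (p5, gen 29; `proofs/P5-GM1.md` §34(5);
announced INBOX 13565 / 13632)

On a coloop-free matroid of nullity `ν(N) = #E − ρ(E) ≤ 2` every line has at most `3` points: a proper subset `T`
of `E` whose complement holds a non-coloop has `ν(T) < ν(E)` (`nullity_lt_of_not_coloop`), and four pairwise
non-parallel points of a line form a rank-`2` set of nullity `≥ 2`.  Hence `thresholdIneq_three_of_lines_le_three_all`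
gives `(I_t)` at co-rank `3` for every `t ≥ 2` (`thresholdIneq_three_of_nullity_le_two`; the rank-`≤ 2` case is
empty).  With `thresholdIneq_three_of_line_card_le_nullity` (`ν(N) ≥` every line) the open core of the co-rank-`3`
threshold family is exactly the coloop-free matroids with `3 ≤ ν(N) <` the length of some line.
-/

open scoped Matroid

namespace PercRepro.Cogirth

open Finset ThmH Skew Shadow Profile

variable {α : Type} [DecidableEq α] {N : Matroid α} [N.Finite]

section NullityTwo

variable {t : ℕ}

/-- **Nullity grows strictly across a non-coloop**: for `T ⊆ E` and `z ∈ E ∖ T` with `ρ(E ∖ z) = ρ(E)`,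
`#T − ρ(T) + 1 ≤ #E − ρ(E)` (written without subtraction). -/
theorem nullity_lt_of_not_coloop {T : Finset α} (hT : T ⊆ gr N) {z : α} (hz : z ∈ gr N) (hzT : z ∉ T)
    (hzc : rk N ((gr N).erase z) = rk N (gr N)) :
    T.card + rk N (gr N) + 1 ≤ (gr N).card + rk N T := by
  have hsub : (gr N).erase z ⊆ T ∪ ((gr N).erase z \ T) := by
    intro y hy
    by_cases hyT : y ∈ T
    · exact mem_union_left _ hyT
    · exact mem_union_right _ (mem_sdiff.2 ⟨hy, hyT⟩)
  have h1 : rk N ((gr N).erase z) ≤ rk N T + rk N ((gr N).erase z \ T) :=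
    (rk_mono' hsub).trans (rk_union_le _ _)
  have h2 : rk N ((gr N).erase z \ T) ≤ ((gr N).erase z \ T).card := rk_le_card _
  have hTz : T ⊆ (gr N).erase z := fun y hy => mem_erase.2 ⟨fun h => hzT (h ▸ hy), hT hy⟩
  have h3 : ((gr N).erase z \ T).card = ((gr N).erase z).card - T.card := card_sdiff_of_subset hTz
  have h4 : T.card ≤ ((gr N).erase z).card := card_le_card hTz
  have h5 : ((gr N).erase z).card = (gr N).card - 1 := card_erase_of_mem hz
  have h6 : 0 < (gr N).card := card_pos.2 ⟨z, hz⟩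
  omega

/-- **Nullity `≤ 2` and no coloop force lines of at most `3` points** (when `ρ(E) ≥ 3`): four pairwise
non-parallel points of a rank-`2` flat would form a proper rank-`2` subset of nullity `≥ 2`. -/
theorem lines_le_three_of_nullity_le_two (hcf : ∀ z ∈ gr N, rk N ((gr N).erase z) = rk N (gr N))
    (hnu : (gr N).card ≤ rk N (gr N) + 2) (hR : 3 ≤ rk N (gr N)) :
    ∀ B ∈ Rq N 2, ∀ T ⊆ clF N B, (∀ x ∈ T, ∀ y ∈ T, x ≠ y → rk N {x, y} = 2) → T.card ≤ 3 := by
  intro B hB T hT hpair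
  by_contra hlt
  push Not at hlt
  have hBrk : rk N B = 2 := rk_eq_of_eRk_eq_cq (mem_Rq.1 hB).2
  have hTg : T ⊆ gr N := hT.trans (clF_subset_gr B)
  have hTrk : rk N T ≤ 2 := by
    have := rk_mono' (M := N) hT
    rwa [rk_clF, hBrk] at this
  -- `T` is a proper subset of `E`: its rank is `≤ 2 < 3 ≤ ρ(E)`
  have hne : ∃ z ∈ gr N, z ∉ T := by
    by_contra hall
    push Not at hall
    have hTE : T = gr N := Subset.antisymm hTg (fun z hz => hall z hz)
    rw [hTE] at hTrk
    omega
  obtain ⟨z, hz, hzT⟩ := hne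
  have h := nullity_lt_of_not_coloop hTg hz hzT (hcf z hz)
  omega

/-- **The co-rank-`3` threshold family at nullity `≤ 2`**: on every coloop-free matroid with `#E ≤ ρ(E) + 2`,
`ThresholdIneq N 3 t` for every `t ≥ 2`. -/
theorem thresholdIneq_three_of_nullity_le_two (hcf : ∀ z ∈ gr N, rk N ((gr N).erase z) = rk N (gr N))
    (hnu : (gr N).card ≤ rk N (gr N) + 2) (ht : 2 ≤ t) : ThresholdIneq N 3 t := by
  rcases lt_or_ge (rk N (gr N)) 3 with hR | hR
  · -- rank `≤ 2`: no rank-`2` set has a complement of rank `≥ 3`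
    unfold ThresholdIneq thresholdSum
    have hzero : ∀ B ∈ Rq N (3 - 1), (if t + 1 ≤ rk N (gr N \ B) then rk N (gr N \ B) else 0) = 0 := by
      intro B _
      rw [if_neg]
      have := rk_mono' (M := N) (sdiff_subset : gr N \ B ⊆ gr N)
      omega
    rw [sum_congr rfl hzero, sum_const_zero]
    exact Nat.zero_le _
  · exact thresholdIneq_three_of_lines_le_three_all (lines_le_three_of_nullity_le_two hcf hnu hR) ht

end NullityTwo

end PercRepro.Cogirth
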